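import Mathlib.Algebra.QuaternionBasis
import Mathlib.LinearAlgebra.Matrix.Adjugate
import Mathlib.Data.Matrix.Reflection
import HarnessLib

/-!
# The explicit splitting `ℍ[T,α,β] ≃ M₂(T)` over a commutative ring (`β = s² - α t²`)

Topic `NumberTheory/Automorphic`; definitions and theorems only (no named fact). For a
commutative ring `T`, `α, s, t ∈ T` and `β = s² - α t²` (i.e. `β` is a norm from `T[√α]`), the
matrices `I = (0 α; 1 0)`, `J = (s, -α t; t, -s)` satisfy `I² = α`, `J² = β`, `IJ = -JI`
(`splitBasis`), whence the `T`-algebra map **`splitHom : ℍ[T,α,β] →ₐ[T] M₂(T)`** (Vignéras,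
LNM 800, Ch. I §2 Cor. 2.4: `{L, θ} ≃ M₂(K)` when `θ ∈ n(L)`; Ch. II §1 Lemme 1.10), written out
in coordinates (`splitHom_apply`, `splitLin`). We prove, over any commutative ring:

* `det_splitHom` : `det ψ(q) = q₀² - α q₁² - β q₂² + αβ q₃²` (the reduced norm) and
  `splitHom_star` : `ψ(q̄) = adj ψ(q)`;
* `splitInv`, `splitLin_splitInv`, `splitInv_splitLin` : an explicit `T`-linear quasi-inverse
  `Λ† : M₂(T) → T⁴` with `Λ Λ† = 2αβ` and `Λ† Λ = 2αβ` (no division: the formulas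
  `c₀ = (r+u)/2, c₁ = (α t' + s')/(2α), …` of `QuaternionAlgebraIntegralSplitting` multiplied
  through by `2αβ`);
* hence, when `2αβ ∈ Tˣ`, `splitHom` is bijective (`splitHom_injective`, `splitHom_surjective`,
  `splitEquiv : ℍ[T,α,β] ≃ₐ[T] M₂(T)`), with the explicit section `splitSection`
  (`splitHom_splitSection`).

This is the comm-ring form (needed over the finite adele ring, which is not a field) of the
field-level `matBasis`/`matModelHom` of `QuaternionCoordOrderHeckeProofs` and of
`QuaternionAlgebraSplitting.QuaternionAlgebra.nonempty_algEquiv_matrix_iff`; it is the algebraic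
input of strong approximation for the norm-one group of a *split* `ℍ[K,a,b]`
(`QuaternionCoordOrderSplitProofs`).

## References

* M.-F. Vignéras, *Arithmétique des algèbres de quaternions*, LNM 800 (1980), Ch. I §2 Cor. 2.4;
  Ch. II §1 Lemme 1.10 [VignerasLNM800].
-/

noncomputable section

open scoped Quaternion

namespace Literature.NumberTheory.Automorphic

namespace QuaternionAlgebra

section CommRing

variable {T : Type*} [CommRing T] (α β s t : T)

/-- For `s² - α t² = β`, the matrices `I = (0 α; 1 0)`, `J = (s, -α t; t, -s)`, `K = IJ` form a
quaternionic basis of type `(α, 0, β)` of `M₂(T)` over the commutative ring `T`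
(Vignéras I §2 Cor. 2.4). [cite: VignerasLNM800, Ch. I §2 Cor. 2.4] -/
def splitBasis (hst : s ^ 2 - α * t ^ 2 = β) :
    _root_.QuaternionAlgebra.Basis (Matrix (Fin 2) (Fin 2) T) α 0 β where
  i := !![0, α; 1, 0]
  j := !![s, -(α * t); t, -s]
  k := !![0, α; 1, 0] * !![s, -(α * t); t, -s]
  i_mul_i := by
    ext i j
    fin_cases i <;> fin_cases j <;> simp [Matrix.mul_apply, Fin.sum_univ_two]
  j_mul_j := by
    subst hst
    ext i j
    fin_cases i <;> fin_cases j <;> simp [Matrix.mul_apply, Fin.sum_univ_two] <;> ring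
  i_mul_j := rfl
  j_mul_i := by
    ext i j
    fin_cases i <;> fin_cases j <;> simp [Matrix.mul_apply, Fin.sum_univ_two] <;> ring

/-- **The splitting `ψ : ℍ[T,α,β] →ₐ[T] M₂(T)`** attached to `splitBasis` (`β = s² - α t²`).
[cite: VignerasLNM800, Ch. I §2 Cor. 2.4] -/
def splitHom (hst : s ^ 2 - α * t ^ 2 = β) : ℍ[T,α,β] →ₐ[T] Matrix (Fin 2) (Fin 2) T :=
  (splitBasis α β s t hst).liftHom

/-- The linear part `Λ : T⁴ → M₂(T)`, `c ↦ c₀ + c₁ I + c₂ J + c₃ IJ`, written out. [folklore] -/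
def splitLin : (Fin 4 → T) →ₗ[T] Matrix (Fin 2) (Fin 2) T where
  toFun c := !![c 0 + c 2 * s + c 3 * (α * t), c 1 * α - c 2 * (α * t) - c 3 * (α * s);
    c 1 + c 2 * t + c 3 * s, c 0 - c 2 * s - c 3 * (α * t)]
  map_add' c d := by
    ext i j
    fin_cases i <;> fin_cases j <;> simp <;> ring
  map_smul' c d := by
    ext i j
    fin_cases i <;> fin_cases j <;> simp <;> ring

/-- Unfolding of `splitLin`. [folklore] -/
theorem splitLin_apply (c : Fin 4 → T) :
    splitLin α s t c = !![c 0 + c 2 * s + c 3 * (α * t), c 1 * α - c 2 * (α * t) - c 3 * (α * s);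
      c 1 + c 2 * t + c 3 * s, c 0 - c 2 * s - c 3 * (α * t)] :=
  rfl

variable {α β s t}

/-- `ψ` in coordinates: `ψ(q) = q₀ + q₁ I + q₂ J + q₃ IJ`. [folklore] -/
theorem splitHom_apply (hst : s ^ 2 - α * t ^ 2 = β) (q : ℍ[T,α,β]) :
    splitHom α β s t hst q = splitLin α s t ![q.re, q.imI, q.imJ, q.imK] := by
  rw [splitLin_apply]
  ext i j
  fin_cases i <;> fin_cases j <;>
    simp [splitHom, splitBasis, _root_.QuaternionAlgebra.Basis.lift,
      Algebra.algebraMap_eq_smul_one] <;> ring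

/-- **`det ψ(q) = n(q) = q₀² - α q₁² - β q₂² + αβ q₃²`.** [cite: VignerasLNM800, Ch. I §2 Cor. 2.4] -/
theorem det_splitHom (hst : s ^ 2 - α * t ^ 2 = β) (q : ℍ[T,α,β]) :
    (splitHom α β s t hst q).det = q.re ^ 2 - α * q.imI ^ 2 - β * q.imJ ^ 2 + α * β * q.imK ^ 2 := by
  rw [splitHom_apply, splitLin_apply, Matrix.det_fin_two_of]
  subst hst
  simp only [Matrix.cons_val_zero, Matrix.cons_val_one, Matrix.cons_val]
  ring

/-- `ψ(q̄) = adj ψ(q)`. [cite: VignerasLNM800, Ch. I §1 (M(2,K), h̄ = adjoint)] -/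
theorem splitHom_star (hst : s ^ 2 - α * t ^ 2 = β) (q : ℍ[T,α,β]) :
    splitHom α β s t hst (star q) = (splitHom α β s t hst q).adjugate := by
  rw [splitHom_apply, splitHom_apply, splitLin_apply, splitLin_apply, Matrix.adjugate_fin_two]
  ext i j
  fin_cases i <;> fin_cases j <;> simp <;> ring

variable (α β s t)

/-- The quasi-inverse `Λ† : M₂(T) → T⁴` of `Λ` (`Λ Λ† = Λ† Λ = 2αβ`): for `m = (r s'; t' u)`,
`Λ†(m) = (αβ (r + u), β (s' + α t'), α (s (r - u) - t (α t' - s')), s (α t' - s') - α t (r - u))`.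
[folklore] -/
def splitInv : Matrix (Fin 2) (Fin 2) T →ₗ[T] (Fin 4 → T) where
  toFun m := ![α * β * (m 0 0 + m 1 1), β * (m 0 1 + α * m 1 0),
    α * (s * (m 0 0 - m 1 1) - t * (α * m 1 0 - m 0 1)),
    s * (α * m 1 0 - m 0 1) - α * t * (m 0 0 - m 1 1)]
  map_add' m n := by
    ext i
    fin_cases i <;> simp <;> ring
  map_smul' c m := by
    ext i
    fin_cases i <;> simp <;> ring

/-- Unfolding of `splitInv`. [folklore] -/
theorem splitInv_apply (m : Matrix (Fin 2) (Fin 2) T) :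
    splitInv α β s t m = ![α * β * (m 0 0 + m 1 1), β * (m 0 1 + α * m 1 0),
      α * (s * (m 0 0 - m 1 1) - t * (α * m 1 0 - m 0 1)),
      s * (α * m 1 0 - m 0 1) - α * t * (m 0 0 - m 1 1)] :=
  rfl

variable {α β s t}

/-- `Λ (Λ† m) = 2αβ · m`. [folklore] -/
theorem splitLin_splitInv (hst : s ^ 2 - α * t ^ 2 = β) (m : Matrix (Fin 2) (Fin 2) T) :
    splitLin α s t (splitInv α β s t m) = (2 * α * β) • m := by
  subst hst
  rw [splitInv_apply, splitLin_apply]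
  ext i j
  fin_cases i <;> fin_cases j <;> simp <;> ring

/-- `Λ† (Λ c) = 2αβ · c`. [folklore] -/
theorem splitInv_splitLin (hst : s ^ 2 - α * t ^ 2 = β) (c : Fin 4 → T) :
    splitInv α β s t (splitLin α s t c) = (2 * α * β) • c := by
  subst hst
  rw [splitLin_apply, splitInv_apply]
  ext i
  fin_cases i <;> simp <;> ring

/-- `ψ` is injective as soon as `2αβ` is a unit. [cite: VignerasLNM800, Ch. I §2 Cor. 2.4] -/
theorem splitHom_injective (hst : s ^ 2 - α * t ^ 2 = β) (hδ : IsUnit (2 * α * β)) :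
    Function.Injective (splitHom α β s t hst) := by
  intro q q' h
  rw [splitHom_apply, splitHom_apply] at h
  have h' := congrArg (fun m => ((hδ.unit⁻¹ : Tˣ) : T) • splitInv α β s t m) h
  simp only [splitInv_splitLin hst, smul_smul, IsUnit.val_inv_mul, one_smul] at h'
  ext
  · exact congrFun h' 0
  · exact congrFun h' 1
  · exact congrFun h' 2
  · exact congrFun h' 3

variable (s t) in
/-- The explicit right inverse `M₂(T) → ℍ[T,α,β]` of `ψ` (`2αβ ∈ Tˣ`): the quaternion with
coordinates `(2αβ)⁻¹ Λ†(m)`. [folklore] -/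
def splitSection (hδ : IsUnit (2 * α * β)) (m : Matrix (Fin 2) (Fin 2) T) : ℍ[T,α,β] :=
  ⟨((hδ.unit⁻¹ : Tˣ) : T) * splitInv α β s t m 0, ((hδ.unit⁻¹ : Tˣ) : T) * splitInv α β s t m 1,
    ((hδ.unit⁻¹ : Tˣ) : T) * splitInv α β s t m 2, ((hδ.unit⁻¹ : Tˣ) : T) * splitInv α β s t m 3⟩

/-- The coordinates of `splitSection m`. [folklore] -/
theorem splitSection_re (hδ : IsUnit (2 * α * β)) (m : Matrix (Fin 2) (Fin 2) T) :
    (splitSection s t hδ m).re = ((hδ.unit⁻¹ : Tˣ) : T) * (α * β * (m 0 0 + m 1 1)) :=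
  rfl

/-- The coordinates of `splitSection m`. [folklore] -/
theorem splitSection_imI (hδ : IsUnit (2 * α * β)) (m : Matrix (Fin 2) (Fin 2) T) :
    (splitSection s t hδ m).imI = ((hδ.unit⁻¹ : Tˣ) : T) * (β * (m 0 1 + α * m 1 0)) :=
  rfl

/-- The coordinates of `splitSection m`. [folklore] -/
theorem splitSection_imJ (hδ : IsUnit (2 * α * β)) (m : Matrix (Fin 2) (Fin 2) T) :
    (splitSection s t hδ m).imJ =
      ((hδ.unit⁻¹ : Tˣ) : T) * (α * (s * (m 0 0 - m 1 1) - t * (α * m 1 0 - m 0 1))) :=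
  rfl

/-- The coordinates of `splitSection m`. [folklore] -/
theorem splitSection_imK (hδ : IsUnit (2 * α * β)) (m : Matrix (Fin 2) (Fin 2) T) :
    (splitSection s t hδ m).imK =
      ((hδ.unit⁻¹ : Tˣ) : T) * (s * (α * m 1 0 - m 0 1) - α * t * (m 0 0 - m 1 1)) :=
  rfl

/-- `splitSection 1 = 1`. [folklore] -/
theorem splitSection_one (hδ : IsUnit (2 * α * β)) :
    splitSection s t hδ (1 : Matrix (Fin 2) (Fin 2) T) = 1 := by
  have h1 : ((hδ.unit⁻¹ : Tˣ) : T) * (α * β * (1 + 1)) = 1 := by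
    rw [show α * β * (1 + 1) = 2 * α * β by ring]
    exact hδ.val_inv_mul
  ext <;> simp [splitSection_re, splitSection_imI, splitSection_imJ, splitSection_imK, h1]

/-- `ψ (splitSection m) = m`. [folklore] -/
theorem splitHom_splitSection (hst : s ^ 2 - α * t ^ 2 = β) (hδ : IsUnit (2 * α * β))
    (m : Matrix (Fin 2) (Fin 2) T) : splitHom α β s t hst (splitSection s t hδ m) = m := by
  have hc : (![((hδ.unit⁻¹ : Tˣ) : T) * splitInv α β s t m 0, ((hδ.unit⁻¹ : Tˣ) : T) * splitInv α β s t m 1,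
      ((hδ.unit⁻¹ : Tˣ) : T) * splitInv α β s t m 2, ((hδ.unit⁻¹ : Tˣ) : T) * splitInv α β s t m 3] :
        Fin 4 → T) = ((hδ.unit⁻¹ : Tˣ) : T) • splitInv α β s t m := by
    ext i
    fin_cases i <;> rfl
  rw [splitHom_apply, splitSection, hc, map_smul, splitLin_splitInv hst, smul_smul, hδ.val_inv_mul,
    one_smul]

/-- `ψ` is onto as soon as `2αβ` is a unit. [cite: VignerasLNM800, Ch. I §2 Cor. 2.4] -/
theorem splitHom_surjective (hst : s ^ 2 - α * t ^ 2 = β) (hδ : IsUnit (2 * α * β)) :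
    Function.Surjective (splitHom α β s t hst) :=
  fun m => ⟨splitSection s t hδ m, splitHom_splitSection hst hδ m⟩

/-- **`ℍ[T,α,β] ≃ₐ[T] M₂(T)`** for `β = s² - α t²` and `2αβ ∈ Tˣ` (Vignéras I §2 Cor. 2.4 over a
commutative ring). [cite: VignerasLNM800, Ch. I §2 Cor. 2.4] -/
def splitEquiv (hst : s ^ 2 - α * t ^ 2 = β) (hδ : IsUnit (2 * α * β)) :
    ℍ[T,α,β] ≃ₐ[T] Matrix (Fin 2) (Fin 2) T :=
  AlgEquiv.ofBijective (splitHom α β s t hst) ⟨splitHom_injective hst hδ, splitHom_surjective hst hδ⟩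

/-- Unfolding of `splitEquiv`. [folklore] -/
@[simp]
theorem splitEquiv_apply (hst : s ^ 2 - α * t ^ 2 = β) (hδ : IsUnit (2 * α * β)) (q : ℍ[T,α,β]) :
    splitEquiv hst hδ q = splitHom α β s t hst q :=
  rfl

/-- `(splitEquiv)⁻¹ = splitSection`. [folklore] -/
theorem splitEquiv_symm_apply (hst : s ^ 2 - α * t ^ 2 = β) (hδ : IsUnit (2 * α * β))
    (m : Matrix (Fin 2) (Fin 2) T) : (splitEquiv hst hδ).symm m = splitSection s t hδ m :=
  (splitEquiv hst hδ).injective (by rw [AlgEquiv.apply_symm_apply, splitEquiv_apply,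
    splitHom_splitSection hst hδ])

/-- `ψ` along a ring map: `ψ_{T'}(f q) = f (ψ_T q)` entrywise, for the images of `α, β, s, t`
(both sides are the same polynomials in the coordinates). [folklore] -/
theorem splitHom_map {T' : Type*} [CommRing T'] (f : T →+* T') (hst : s ^ 2 - α * t ^ 2 = β)
    (hst' : f s ^ 2 - f α * f t ^ 2 = f β) (q : ℍ[T,α,β]) :
    splitHom (f α) (f β) (f s) (f t) hst' ⟨f q.re, f q.imI, f q.imJ, f q.imK⟩ =
      (splitHom α β s t hst q).map f := by
  rw [splitHom_apply, splitHom_apply, splitLin_apply, splitLin_apply]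
  ext i j
  fin_cases i <;> fin_cases j <;> simp

end CommRing

end QuaternionAlgebra

end Literature.NumberTheory.Automorphic
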